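import Summits.NavierStokesRegularity.NavierStokesRegularity.Theorems.GaldiLiouvilleGateRecordZoomAncientStubKernelAt
import Summits.NavierStokesRegularity.NavierStokesRegularity.Theorems.GaldiLiouvilleGateRecordZoomAncientStubNormalise
import Summits.NavierStokesRegularity.NavierStokesRegularity.Theorems.GaldiLiouvilleGateRecordZoomAncientStubLocalZoomLimitOseen
import Summits.NavierStokesRegularity.NavierStokesRegularity.Theorems.GaldiLiouvilleGateRecordZoomAncientStubOscNondegenerate
import Summits.NavierStokesRegularity.NavierStokesRegularity.Theorems.GaldiLiouvilleGateRecordZoomAncientStubCutoffEnstrophyPoincare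
import Summits.NavierStokesRegularity.NavierStokesRegularity.Theorems.GaldiLiouvilleGateRecordZoomAncientStubSobolevModConst
import Summits.NavierStokesRegularity.NavierStokesRegularity.Theorems.GaldiLiouvilleGateRecordZoomAncientStubGalileanOseen
import Summits.NavierStokesRegularity.NavierStokesRegularity.Theorems.HardyPointSinkHardyAncientLimitClassical
import Literature.Analysis.FluidPDE.OseenAncientLpPropagation
import Literature.Analysis.FluidPDE.KNSSTypeIRateLiouvilleMild
import HarnessLib

/-!
# Route `GaldiLiouvilleGate`, crux `RecordZoomAncient` (stmt-NavierStokesRegularity-0894),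
  line `registered`, reshape r8 — the OSCILLATION-BUMP RUNG and `Z` from the r8 kernel

Lead `prover-line-stmt-NavierStokesRegularity-0894-c4-0`, 2026-08-17. Two theorems (namespace
`…Theorems.RecordZoomAncient.Birth`):

* `recordZoomAncientAt_of_oscillationBump` — **the r8 rung** (no `L⁶` and no near-maximal-velocity hypothesis):
  for a classical solution `(u, p)` on `ℝ³ × [0, T)`, Leray–Hopf from `u 0`: base times `tc n ∈ (0,T)`, point
  pairs `x₁ n, x₂ n` with `‖x₁ n − x₂ n‖ ≤ R₀ν/M n`, velocity levels `M n > 0` dominating `‖u‖` on `[0, tc n] × ℝ³`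
  with `tc n (M n)² → ∞`, an oscillation `‖u(tc n, x₁ n) − u(tc n, x₂ n)‖ ≥ θ M n`, and, for every `R, S > 0`
  eventually in `n`, local enstrophy `≤ DνM n` of `u(t)` in `B(x₁ n, Rν/M n)` on `[tc n − Sν/(M n)², tc n] ∩ [0,tc n]`,
  produce a NONTRIVIAL bounded ancient mild solution (`ν = 1`), smooth on `(−∞,0) × ℝ³`, with `∫|∇v(s)|² ≤ 1` and
  `v(s) ∈ L⁶` for all `s < 0`. Mechanism: velocity zooms centred at `x₁ n`; the Oseen-mild limit `W`
  (`stub_localZoomLimitOseen`, p165139) is NON-CONSTANT at time `s₁(θ)` (`stub_oscNondegenerate`, p165341; the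
  companion points `(M n/ν)(x₂ n − x₁ n)` subconverge and the zooms converge locally uniformly); every slice of `W`
  has enstrophy `≤ cD` (`stub_cutoffEnstrophyPoincare`, p165484); `W(s) − c(s) ∈ L⁶` for some constant `c(s)`
  (`stub_sobolevModConst`, p165551); the Galilean image `W̃(t,y) = W(t, y + tc) − c`, `c = c(−1)`, is bounded
  Oseen-mild (`stub_galileanOseen`, p165762), hence a bounded ancient mild solution
  (`isBoundedAncientMildSolution_of_oseen`), smooth (`HardyAncientLimit.isSmoothSpaceTimeOn_of_oseen`), with the same
  enstrophy, and with `L⁶` slices by FORWARD PROPAGATION of `L⁶` along bounded Oseen-mild ancient fields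
  (`oseenAncient_memLp_of_le`, `p = 6`): boosting by `c(s')`, `s' = min(s, −1)`, and comparing the propagated slice
  at time `−1` with `W(−1) − c(−1) ∈ L⁶` shows `c(s') = c` (a constant in `L⁶(ℝ³)` vanishes); `W̃(s₁) ≢ 0` since
  `W(s₁)` is not constant; normalise (`stub_normalise`, p162442).
* `recordZoomAncient_of_oscillationKernel` — **`Z` from the r8 kernel** (`stub_oscillationKernel` of
  `Cruxes/RecordZoomAncient/Lines/birth.lean`, verbatim as a hypothesis): split on the existence of a persistent
  critical oscillation bump — yes: the rung; no: the pointwise r5 composition `stub_kernelAt` (p162337) fed with the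
  kernel. The r8 kernel is implied by the r7 one (`recordZoomAncient_of_diffuseFaintKernel`, p163700), hence weaker.

Sources: G. Koch, N. Nadirashvili, G. Seregin, V. Šverák, Acta Math. 203 (2009), Lemma 6.1, Prop. 4.1, §§3–4 (the
parasitic drift and its Galilean removal); P. G. Lemarié-Rieusset, *The Navier–Stokes Problem in the 21st Century*
(2016), §9.9 (propagation of `L^p` along bounded Oseen-mild solutions).
-/

noncomputable section

open Set MeasureTheory Filter Topology Function
open scoped ENNReal NNReal
open Literature.Analysis.FluidPDE

namespace Summit.NavierStokesRegularity.NavierStokesRegularity.Theorems.RecordZoomAncient.Birth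

-- the problem-side namespace `Summit.NavierStokesRegularity.NavierStokesRegularity.…` (summit =
-- problem for this single-problem summit) duplicates `NavierStokesRegularity` by design
set_option linter.dupNamespace false

/-- **The r8 rung: a persistent critical OSCILLATION bump with bounded local enstrophy history gives the conclusion
of the crux.** (No `L⁶` and no near-maximal-velocity hypothesis.) Proof: velocity zooms centred at `x₁ n`
(`stub_localZoomLimitOseen`); the limit is non-constant at time `s₁(θ)` (`stub_oscNondegenerate`, locally uniform
convergence at the companion points `(M n/ν)(x₂ n − x₁ n) → y*`); every limit slice has enstrophy `≤ cD`
(`stub_cutoffEnstrophyPoincare`); Sobolev modulo constants (`stub_sobolevModConst`) gives `W(s) − c(s) ∈ L⁶`; the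
Galilean image `W̃ = W(·, · + t c) − c`, `c = c(−1)` is bounded Oseen-mild (`stub_galileanOseen`), hence a bounded
ancient mild solution (`isBoundedAncientMildSolution_of_oseen`), smooth (`HardyAncientLimit.isSmoothSpaceTimeOn_of_oseen`),
with the same enstrophy, and with `L⁶` slices by FORWARD PROPAGATION of `L⁶` along bounded Oseen-mild ancient fields
(`oseenAncient_memLp_of_le`, `p = 6`; comparing the propagated slice with `stub_sobolevModConst` at a common time
shows `c(s) = c` for every `s`, so every slice of `W̃` is `L⁶`); `W̃(s₁) ≢ 0` because `W(s₁)` is not constant;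
normalise (`stub_normalise`, p162442). -/
theorem recordZoomAncientAt_of_oscillationBump :
    ∀ (ν T : ℝ), 0 < ν → 0 < T → ∀ (u : ℝ → EuclideanSpace ℝ (Fin 3) → EuclideanSpace ℝ (Fin 3)) (p : ℝ →
      EuclideanSpace ℝ (Fin 3) → ℝ), IsClassicalNSSolutionOn (Set.Ico 0 T) ν 0 u p → IsLerayHopfOn T ν 0 (u 0)
      u → ∀ (tc : ℕ → ℝ) (x₁ x₂ : ℕ → EuclideanSpace ℝ (Fin 3)) (M : ℕ → ℝ) (θ R₀ D : ℝ), (∀ n, 0 < tc n ∧ tc n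
      < T) → (∀ n, 0 < M n) → (∀ n, ∀ t ∈ Set.Icc 0 (tc n), ∀ x, ‖u t x‖ ≤ M n) → Filter.Tendsto (fun n => tc n
      * M n ^ 2) Filter.atTop Filter.atTop → 0 < θ → 0 < R₀ → (∀ n, ‖x₁ n - x₂ n‖ ≤ R₀ * (ν / M n)) → (∀ n, θ *
      M n ≤ ‖u (tc n) (x₁ n) - u (tc n) (x₂ n)‖) → (∀ R S : ℝ, 0 < R → 0 < S → ∀ᶠ n in Filter.atTop, ∀ t ∈
      Set.Icc 0 (tc n), tc n - S * (ν / M n ^ 2) ≤ t → (∫⁻ y in Metric.ball (x₁ n) (R * (ν / M n)),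
      ENNReal.ofReal (frobeniusNormSq (fderiv ℝ (u t) y))) ≤ ENNReal.ofReal (D * (ν * M n))) → ∃ v : ℝ →
      EuclideanSpace ℝ (Fin 3) → EuclideanSpace ℝ (Fin 3), IsBoundedAncientMildSolution 1 v ∧ ContDiffOn ℝ (⊤ :
      ℕ∞) (Function.uncurry v) (Set.Iio 0 ×ˢ Set.univ) ∧ (∀ s < 0, ∫⁻ y, ENNReal.ofReal (frobeniusNormSq
      (fderiv ℝ (v s) y)) ≤ 1) ∧ (∀ s < 0, MeasureTheory.MemLp (v s) 6 MeasureTheory.volume) ∧ ¬ (∀ s < 0, ∀ y,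
      v s y = 0) := by
  intro ν T hν hT u p hcl hLH tc x₁ x₂ M θ R₀ D htc hM hdomV hpast hθ hR₀ hdist hosc hE
  -- ### WLOG `D ≥ 0`
  set D' : ℝ := max D 0 with hD'def
  have hD'0 : 0 ≤ D' := le_max_right _ _
  have hE' : ∀ R S : ℝ, 0 < R → 0 < S → ∀ᶠ n in atTop, ∀ t ∈ Set.Icc 0 (tc n), tc n - S * (ν / M n ^ 2) ≤ t →
      (∫⁻ y in Metric.ball (x₁ n) (R * (ν / M n)), ENNReal.ofReal (frobeniusNormSq (fderiv ℝ (u t) y))) ≤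
        ENNReal.ofReal (D' * (ν * M n)) := by
    intro R S hR hS
    filter_upwards [hE R S hR hS] with n hn t ht hst
    refine (hn t ht hst).trans (ENNReal.ofReal_le_ofReal ?_)
    exact mul_le_mul_of_nonneg_right (le_max_left _ _) (mul_pos hν (hM n)).le
  -- ### the zooms centred at `x₁ n` and their Oseen-mild limit
  set z : ℕ → ℝ → EuclideanSpace ℝ (Fin 3) → EuclideanSpace ℝ (Fin 3) :=
    fun n s y => (M n)⁻¹ • u (tc n + ν / M n ^ 2 * s) (x₁ n + (ν / M n) • y) with hz_def
  have hz : ∀ n s y, z n s y = (M n)⁻¹ • u (tc n + ν / M n ^ 2 * s) (x₁ n + (ν / M n) • y) :=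
    fun n s y => rfl
  obtain ⟨φ, W, hφ, hconv, hlocu, hWc, hWb, hWdiv, hWmild, hsm, hZE⟩ :=
    stub_localZoomLimitOseen ν T hν hT u p hcl hLH tc x₁ M D' htc hM hdomV hpast hE' z hz
  have hsm' : IsSmoothSpaceTimeOn (Set.Iio 0) W := hsm
  have hWC1 : ∀ s < 0, ContDiff ℝ 1 (W s) := fun s hs => (hsm'.contDiff_slice hs).of_le (by norm_cast)
  have hβpos : ∀ n, 0 < ν / M n ^ 2 := fun n => div_pos hν (pow_pos (hM n) 2)
  have hγpos : ∀ n, 0 < ν / M n := fun n => div_pos hν (hM n)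
  -- ### (A) finite enstrophy of every limit slice
  obtain ⟨cP, hcP, hcut⟩ := stub_cutoffEnstrophyPoincare
  have hens : ∀ s < 0, ∫⁻ y, ENNReal.ofReal (frobeniusNormSq (fderiv ℝ (W s) y)) ≤ ENNReal.ofReal (cP * D') := by
    intro s hs
    have hevA : ∀ᶠ k in atTop, -s * (ν / M (φ k) ^ 2) < tc (φ k) := by
      have h1 : Tendsto (fun k => tc (φ k) * M (φ k) ^ 2) atTop atTop := hpast.comp hφ.tendsto_atTop
      filter_upwards [h1.eventually (eventually_gt_atTop (-s * ν))] with k hk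
      have h2 : -s * (ν / M (φ k) ^ 2) = (-s * ν) / M (φ k) ^ 2 := by ring
      rw [h2, div_lt_iff₀ (pow_pos (hM _) 2)]
      exact hk
    obtain ⟨N, hN⟩ := eventually_atTop.1 hevA
    set f : ℕ → EuclideanSpace ℝ (Fin 3) → EuclideanSpace ℝ (Fin 3) := fun k => z (φ (k + N)) s with hf_def
    have hmem : ∀ k, tc (φ (k + N)) + ν / M (φ (k + N)) ^ 2 * s ∈ Set.Ioc 0 (tc (φ (k + N))) := by
      intro k
      have h1 := hN (k + N) (Nat.le_add_left N k)
      have h2 : ν / M (φ (k + N)) ^ 2 * s ≤ 0 :=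
        mul_nonpos_of_nonneg_of_nonpos (hβpos _).le hs.le
      constructor <;> nlinarith [hβpos (φ (k + N))]
    have hf1 : ∀ k, ContDiff ℝ 1 (f k) := by
      intro k
      have ht : tc (φ (k + N)) + ν / M (φ (k + N)) ^ 2 * s ∈ Set.Ico 0 T :=
        ⟨(hmem k).1.le, (hmem k).2.trans_lt (htc _).2⟩
      have hu : ContDiff ℝ 1 (u (tc (φ (k + N)) + ν / M (φ (k + N)) ^ 2 * s)) :=
        (hcl.contDiff_velocity ht).of_le (by norm_cast)
      have hg : ContDiff ℝ 1 (fun y : EuclideanSpace ℝ (Fin 3) => x₁ (φ (k + N)) + (ν / M (φ (k + N))) • y) :=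
        contDiff_const.add (contDiff_id.const_smul _)
      exact (hu.comp hg).const_smul ((M (φ (k + N)))⁻¹)
    have hbd : ∀ k x, ‖f k x‖ ≤ 1 := by
      intro k x
      simp only [hf_def, hz_def, norm_smul, norm_inv, Real.norm_of_nonneg (hM _).le]
      rw [inv_mul_le_iff₀ (hM _), mul_one]
      exact hdomV _ _ ⟨(hmem k).1.le, (hmem k).2⟩ _
    have hconvf : ∀ x, Tendsto (fun k => f k x) atTop (𝓝 (W s x)) := fun x =>
      (hconv s hs x).comp (tendsto_add_atTop_nat N)
    have hEf : ∀ R : ℝ, 0 < R → ∀ᶠ k in atTop,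
        (∫⁻ y in Metric.ball 0 R, ENNReal.ofReal (frobeniusNormSq (fderiv ℝ (f k) y))) ≤ ENNReal.ofReal D' := by
      intro R hR
      have h := (hφ.tendsto_atTop.comp (tendsto_add_atTop_nat N)).eventually (hZE R (-s) hR (neg_pos.2 hs))
      filter_upwards [h] with k hk
      exact hk s ⟨le_rfl.trans (neg_neg s).le, hs.le⟩
    exact hcut f (W s) D' hD'0 hf1 (hWC1 s hs) hbd hconvf hEf
  -- ### (B) the limit is NOT constant at time `s₁`
  obtain ⟨s₁, hs₁, hs₁1, hnd⟩ := stub_oscNondegenerate θ hθ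
  -- companion points in zoom units
  set y₂ : ℕ → EuclideanSpace ℝ (Fin 3) := fun n => (M n / ν) • (x₂ n - x₁ n) with hy₂_def
  have hy₂ : ∀ n, y₂ n ∈ Metric.closedBall (0 : EuclideanSpace ℝ (Fin 3)) R₀ := by
    intro n
    rw [Metric.mem_closedBall, dist_zero_right, hy₂_def, norm_smul, Real.norm_of_nonneg (div_pos (hM n) hν).le,
      norm_sub_rev]
    have hMn : M n ≠ 0 := (hM n).ne'
    have hν0 : ν ≠ 0 := hν.ne'
    calc M n / ν * ‖x₁ n - x₂ n‖ ≤ M n / ν * (R₀ * (ν / M n)) :=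
          mul_le_mul_of_nonneg_left (hdist n) (div_pos (hM n) hν).le
      _ = R₀ := by field_simp
  have hx₂ : ∀ n, x₁ n + (ν / M n) • y₂ n = x₂ n := by
    intro n
    have hMn : M n ≠ 0 := (hM n).ne'
    have hν0 : ν ≠ 0 := hν.ne'
    rw [hy₂_def, smul_smul, show ν / M n * (M n / ν) = 1 by field_simp, one_smul, add_sub_cancel]
  -- eventually the oscillation persists at the zoom time `s₁`
  have hev3 : ∀ᶠ n in atTop, 3 * (ν / M n ^ 2) ≤ tc n := by
    have h := hpast.eventually (eventually_ge_atTop (3 * ν))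
    filter_upwards [h] with n hn
    rw [← div_le_iff₀ (pow_pos (hM n) 2)] at hn
    simpa [mul_div_assoc] using hn
  have hlow : ∀ᶠ k in atTop, θ / 2 ≤ ‖z (φ k) s₁ 0 - z (φ k) s₁ (y₂ (φ k))‖ := by
    filter_upwards [hφ.tendsto_atTop.eventually hev3] with k hk
    have hkey := hnd ν T hν hT u p hcl hLH (tc (φ k)) (x₁ (φ k)) (x₂ (φ k)) (M (φ k)) (htc _).1 (htc _).2
      (hM _) hk (hdomV _) (hosc _)
    rw [hz, hz, smul_zero, add_zero, hx₂, ← smul_sub, norm_smul, norm_inv, Real.norm_of_nonneg (hM _).le,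
      ← div_eq_inv_mul, le_div_iff₀ (hM _)]
    linarith
  -- a further subsequence along which the companion points converge
  obtain ⟨ystar, -, ψ, hψ, hylim⟩ :=
    (isCompact_closedBall (0 : EuclideanSpace ℝ (Fin 3)) R₀).tendsto_subseq fun k => hy₂ (φ k)
  have hWcont₁ : Continuous (W s₁) := (hWC1 s₁ hs₁).continuous
  have hlim0 : Tendsto (fun k => z (φ (ψ k)) s₁ 0) atTop (𝓝 (W s₁ 0)) :=
    (hconv s₁ hs₁ 0).comp hψ.tendsto_atTop
  have hlim2 : Tendsto (fun k => z (φ (ψ k)) s₁ (y₂ (φ (ψ k)))) atTop (𝓝 (W s₁ ystar)) := by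
    have h1 : TendstoLocallyUniformly (fun k => z (φ (ψ k)) s₁) (W s₁) atTop := by
      intro U hU x
      obtain ⟨t, ht, hev⟩ := hlocu s₁ hs₁ U hU x
      exact ⟨t, ht, hψ.tendsto_atTop.eventually hev⟩
    exact h1.tendsto_comp hWcont₁.continuousAt hylim
  have hnc : θ / 2 ≤ ‖W s₁ 0 - W s₁ ystar‖ := by
    have hl : Tendsto (fun k => ‖z (φ (ψ k)) s₁ 0 - z (φ (ψ k)) s₁ (y₂ (φ (ψ k)))‖) atTop
        (𝓝 ‖W s₁ 0 - W s₁ ystar‖) := (hlim0.sub hlim2).norm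
    exact ge_of_tendsto hl (hψ.tendsto_atTop.eventually hlow)
  have hneq : W s₁ 0 ≠ W s₁ ystar := by
    intro h
    rw [h, sub_self, norm_zero] at hnc
    linarith
  -- ### (C) constants at infinity of the limit slices
  have hR1 : ∀ s < 0, ∃ c : EuclideanSpace ℝ (Fin 3), MemLp (fun y => W s y - c) 6 volume := by
    intro s hs
    refine stub_sobolevModConst (W s) (hWC1 s hs) ⟨1, hWb s hs⟩ ?_
    exact ((hens s hs).trans_lt ENNReal.ofReal_lt_top).ne
  choose! cst hcst using hR1
  set c₀ : EuclideanSpace ℝ (Fin 3) := cst (-1) with hc₀_def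
  -- ### (D) the Galilean image
  set Wt : ℝ → EuclideanSpace ℝ (Fin 3) → EuclideanSpace ℝ (Fin 3) := fun t y => W t (y + t • c₀) - c₀ with hWt_def
  obtain ⟨hWtc, hWtb, hWtdiv, hWtmild⟩ :=
    stub_galileanOseen W Wt 1 c₀ hWc hWb hWdiv hWmild (fun _ _ => rfl)
  -- ### (E) `L⁶` slices of the Galilean image, by forward propagation
  have h6ne : (6 : ℝ≥0∞) ≠ ∞ := by norm_num
  have h6ge : (1 : ℝ≥0∞) ≤ 6 := by norm_num
  have hvol : ¬ (volume : Measure (EuclideanSpace ℝ (Fin 3))) Set.univ < ∞ := by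
    simp
  -- translation bookkeeping: `y ↦ g (y + a) ∈ L⁶ ↔ g ∈ L⁶`
  have htr : ∀ (g : EuclideanSpace ℝ (Fin 3) → EuclideanSpace ℝ (Fin 3)) (a : EuclideanSpace ℝ (Fin 3)),
      MemLp g 6 volume → MemLp (fun y => g (y + a)) 6 volume := fun g a hg =>
    hg.comp_measurePreserving (measurePreserving_add_right volume a)
  have hL6 : ∀ s < 0, MemLp (Wt s) 6 volume := by
    intro s hs
    set s' : ℝ := min s (-1) with hs'_def
    have hs'0 : s' < 0 := (min_le_right _ _).trans_lt (by norm_num)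
    have hs's : s' ≤ s := min_le_left _ _
    have hs'1 : s' ≤ -1 := min_le_right _ _
    set c' : EuclideanSpace ℝ (Fin 3) := cst s' with hc'_def
    set W' : ℝ → EuclideanSpace ℝ (Fin 3) → EuclideanSpace ℝ (Fin 3) := fun t y => W t (y + t • c') - c'
      with hW'_def
    obtain ⟨hW'c, hW'b, -, hW'mild⟩ := stub_galileanOseen W W' 1 c' hWc hWb hWdiv hWmild (fun _ _ => rfl)
    -- the slice `s'` of `W'` is `L⁶`
    have hW's' : MemLp (W' s') 6 volume := by
      have h := htr (fun y => W s' y - c') (s' • c') (hcst s' hs'0)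
      exact h
    -- propagate to `-1` and to `s`
    have hprop : ∀ t : ℝ, s' ≤ t → t < 0 → MemLp (W' t) 6 volume := fun t h1 h2 =>
      oseenAncient_memLp_of_le h6ge h6ne hW'c hW'b hW'mild hW's' h1 h2
    -- at time `-1`: `c' = c₀`
    have hcc : c' = c₀ := by
      have h1 : MemLp (W' (-1)) 6 volume := hprop (-1) hs'1 (by norm_num)
      -- translate back: `y ↦ W (-1) y - c'` is `L⁶`
      have h2 : MemLp (fun y => W (-1) y - c') 6 volume := by
        have h := htr (W' (-1)) ((1 : ℝ) • c') h1
        refine h.ae_eq (Eventually.of_forall fun y => ?_)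
        simp only [hW'_def]
        rw [one_smul, neg_one_smul, add_neg_cancel_right]
      have h3 : MemLp (fun y => W (-1) y - c₀) 6 volume := hcst (-1) (by norm_num)
      have h4 : MemLp (fun _ : EuclideanSpace ℝ (Fin 3) => c' - c₀) 6 volume := by
        refine (h3.sub h2).ae_eq (Eventually.of_forall fun y => ?_)
        simp only [Pi.sub_apply]
        exact sub_sub_sub_cancel_left _ _ _
      rcases (memLp_const_iff (by norm_num) h6ne).1 h4 with h | h
      · exact (sub_eq_zero.1 h)
      · exact absurd h hvol
    have hWW : W' = Wt := by
      funext t y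
      simp only [hW'_def, hWt_def, hcc]
    rw [← hWW]
    exact hprop s hs's hs
  -- ### (F) smoothness, (G) enstrophy, (H) mildness, (I) non-triviality of the Galilean image
  have hK0 : (0 : ℝ) ≤ 1 + ‖c₀‖ := by positivity
  have hsmt : IsSmoothSpaceTimeOn (Set.Iio 0) Wt :=
    HardyAncientLimit.isSmoothSpaceTimeOn_of_oseen hWtc hK0 hWtb hWtmild
  have henst : ∀ s < 0, ∫⁻ y, ENNReal.ofReal (frobeniusNormSq (fderiv ℝ (Wt s) y)) ≤ ENNReal.ofReal (cP * D') := by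
    intro s hs
    have hD : ∀ y, fderiv ℝ (Wt s) y = fderiv ℝ (W s) (y + s • c₀) := by
      intro y
      show fderiv ℝ (fun y => W s (y + s • c₀) - c₀) y = _
      rw [fderiv_sub_const, fderiv_comp_add_right]
    simp_rw [hD]
    rw [lintegral_add_right_eq_self (fun y => ENNReal.ofReal (frobeniusNormSq (fderiv ℝ (W s) y))) (s • c₀)]
    exact hens s hs
  have hmildt : IsBoundedAncientMildSolution 1 Wt :=
    isBoundedAncientMildSolution_of_oseen one_pos hWtc ⟨1 + ‖c₀‖, hWtb⟩ hWtdiv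
      (fun s t hst ht x => by rw [one_mul]; exact hWtmild s t hst ht x)
  have hnz : ∃ s < 0, ∃ y, Wt s y ≠ 0 := by
    by_contra hall
    push Not at hall
    have h0 : W s₁ 0 = c₀ := by
      have h := hall s₁ hs₁ (0 - s₁ • c₀)
      simp only [hWt_def, sub_add_cancel] at h
      exact sub_eq_zero.1 h
    have h2 : W s₁ ystar = c₀ := by
      have h := hall s₁ hs₁ (ystar - s₁ • c₀)
      simp only [hWt_def, sub_add_cancel] at h
      exact sub_eq_zero.1 h
    exact hneq (h0.trans h2.symm)
  -- ### (J) normalisation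
  exact stub_normalise Wt (cP * D') hmildt hsmt henst hL6 hnz

/-- **`Z` from the r8 kernel `stub_oscillationKernel`, verbatim as a hypothesis** (the closed twin of the
skeleton `Cruxes/RecordZoomAncient/Lines/birth.lean`, reshape r8). Composition: `by_cases` on the existence of a
persistent critical oscillation bump — yes: `recordZoomAncientAt_of_oscillationBump`; no: `stub_kernelAt` fed with
the kernel. -/
theorem recordZoomAncient_of_oscillationKernel :
    (∀ (ν T : ℝ), 0 < ν → 0 < T → ∀ (u : ℝ → EuclideanSpace ℝ (Fin 3) → EuclideanSpace ℝ (Fin 3)) (p : ℝ →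
      EuclideanSpace ℝ (Fin 3) → ℝ), IsClassicalNSSolutionOn (Set.Ico 0 T) ν 0 u p → IsLerayHopfOn T ν 0 (u 0)
      u → HasRapidSpatialDecay (u 0) → ¬ HasSmoothExtensionPast ν 0 u T → (∀ C : ℝ, 0 < C → ∃ t' ∈ Set.Ico 0 T,
      ∀ t ∈ Set.Ico t' T, ∃ s ∈ Set.Icc 0 t, ENNReal.ofReal (C * (ν * Real.sqrt ν) / Real.sqrt (T - t)) < ∫⁻ x,
      ENNReal.ofReal (frobeniusNormSq (fderiv ℝ (u s) x))) → (∀ K : ℝ, 0 < K → ∃ t' ∈ Set.Ico 0 T, ∀ t₁ ∈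
      Set.Ico t' T, ∀ t₂ ∈ Set.Ioo t₁ T, ∀ L : ℝ, 0 < L → (∀ s ∈ Set.Icc 0 t₂, (∫⁻ x, ENNReal.ofReal
      (frobeniusNormSq (fderiv ℝ (u s) x))) ≤ ENNReal.ofReal (2 * L)) → (∫⁻ x, ENNReal.ofReal (frobeniusNormSq
      (fderiv ℝ (u t₁) x))) ≤ ENNReal.ofReal L → ENNReal.ofReal (2 * L) ≤ (∫⁻ x, ENNReal.ofReal
      (frobeniusNormSq (fderiv ℝ (u t₂) x))) → K * ν ^ 3 / L ^ 2 ≤ t₂ - t₁) → (∀ R ε : ℝ, 0 < R → 0 < ε → ∃ t'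
      ∈ Set.Ico 0 T, ∀ t ∈ Set.Ico t' T, ∀ x : EuclideanSpace ℝ (Fin 3), ∀ L : ℝ, 0 < L → (∀ s ∈ Set.Icc 0 t,
      (∫⁻ x, ENNReal.ofReal (frobeniusNormSq (fderiv ℝ (u s) x))) ≤ ENNReal.ofReal L) → 3 * ν ^ 3 / L ^ 2 ≤ t →
      (∫⁻ y in Metric.ball x (R * ν ^ 2 / L), ENNReal.ofReal (frobeniusNormSq (fderiv ℝ (u t) y))) <
      ENNReal.ofReal (ε * L)) → (∀ θ : ℝ, 0 < θ → ∃ t' ∈ Set.Ico 0 T, ∀ t ∈ Set.Ico t' T, ∀ x : EuclideanSpace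
      ℝ (Fin 3), ∀ L : ℝ, 0 < L → (∀ s ∈ Set.Icc 0 t, (∫⁻ x, ENNReal.ofReal (frobeniusNormSq (fderiv ℝ (u s)
      x))) ≤ ENNReal.ofReal L) → ‖u t x‖ < θ * L / ν) → (∀ (tc : ℕ → ℝ) (x₁ x₂ : ℕ → EuclideanSpace ℝ (Fin 3))
      (M : ℕ → ℝ) (θ R₀ D : ℝ), (∀ n, 0 < tc n ∧ tc n < T) → (∀ n, 0 < M n) → (∀ n, ∀ t ∈ Set.Icc 0 (tc n), ∀
      x, ‖u t x‖ ≤ M n) → Filter.Tendsto (fun n => tc n * M n ^ 2) Filter.atTop Filter.atTop → 0 < θ → 0 < R₀ →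
      (∀ n, ‖x₁ n - x₂ n‖ ≤ R₀ * (ν / M n)) → (∀ n, θ * M n ≤ ‖u (tc n) (x₁ n) - u (tc n) (x₂ n)‖) → (∀ R S :
      ℝ, 0 < R → 0 < S → ∀ᶠ n in Filter.atTop, ∀ t ∈ Set.Icc 0 (tc n), tc n - S * (ν / M n ^ 2) ≤ t → (∫⁻ y in
      Metric.ball (x₁ n) (R * (ν / M n)), ENNReal.ofReal (frobeniusNormSq (fderiv ℝ (u t) y))) ≤ ENNReal.ofReal
      (D * (ν * M n))) → False) → False) →
      Summit.NavierStokesRegularity.NavierStokesRegularity.Theses.GaldiLiouvilleGate.RecordZoomAncient := by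
  intro hKernel ν T hν hT u p hcl hLH hdec hnext
  by_cases hb : ∃ (tc : ℕ → ℝ) (x₁ x₂ : ℕ → EuclideanSpace ℝ (Fin 3)) (M : ℕ → ℝ) (θ R₀ D : ℝ),
      (∀ n, 0 < tc n ∧ tc n < T) ∧ (∀ n, 0 < M n) ∧
      (∀ n, ∀ t ∈ Set.Icc 0 (tc n), ∀ x, ‖u t x‖ ≤ M n) ∧
      Tendsto (fun n => tc n * M n ^ 2) atTop atTop ∧
      0 < θ ∧ 0 < R₀ ∧ (∀ n, ‖x₁ n - x₂ n‖ ≤ R₀ * (ν / M n)) ∧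
      (∀ n, θ * M n ≤ ‖u (tc n) (x₁ n) - u (tc n) (x₂ n)‖) ∧
      (∀ R S : ℝ, 0 < R → 0 < S → ∀ᶠ n in atTop, ∀ t ∈ Set.Icc 0 (tc n), tc n - S * (ν / M n ^ 2) ≤ t →
        (∫⁻ y in Metric.ball (x₁ n) (R * (ν / M n)), ENNReal.ofReal (frobeniusNormSq (fderiv ℝ (u t) y))) ≤
          ENNReal.ofReal (D * (ν * M n)))
  · obtain ⟨tc, x₁, x₂, M, θ, R₀, D, htc, hM, hdomV, hpast, hθ, hR₀, hdist, hosc, hE⟩ := hb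
    exact recordZoomAncientAt_of_oscillationBump ν T hν hT u p hcl hLH tc x₁ x₂ M θ R₀ D htc hM hdomV hpast hθ hR₀
      hdist hosc hE
  · exact stub_kernelAt ν T hν hT u p hcl hLH hdec hnext fun h1 h2 h3 h4 =>
      hKernel ν T hν hT u p hcl hLH hdec hnext h1 h2 h3 h4
        fun tc x₁ x₂ M θ R₀ D htc hM hdomV hpast hθ hR₀ hdist hosc hE =>
          hb ⟨tc, x₁, x₂, M, θ, R₀, D, htc, hM, hdomV, hpast, hθ, hR₀, hdist, hosc, hE⟩

end Summit.NavierStokesRegularity.NavierStokesRegularity.Theorems.RecordZoomAncient.Birth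

end
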